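import Summits.BirchSwinnertonDyer.BirchSwinnertonDyer.Theorems.AlignedTransportAtTwoBSDOfMainConjectureRankOneAtTwoLeadingTermAlgebra
import Literature.NumberTheory.EllipticCurves.CanonicalPAdicHeightSqExistenceProofs
import Literature.NumberTheory.EllipticCurves.IwasawaLeadingTermProofs
import HarnessLib

/-!
# Crux C3′ `BSDOfMainConjectureRankOneAtTwo` (stmt-BirchSwinnertonDyer-23008), line `birth` — TYPING DRAFT for stub L
# (lead `bsd-line-att-p1` g2): candidate texts for the two `p = 2` statements T-23008-a / T-23008-b, and the KERNEL CHECK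
# that, typed in ONE currency, they close stub L through the landed algebra (p594193 §3 L3, p594549 §5 adapter)

WORKFILE, NOT A FILING (D-0014: a prover files no statements). The two `def … : Prop` below are DRAFTS for the planner
(-imc) / refuter (-ref1: A1–A6 + the normalisation census H1–H6 of `Lines/birth.md`) / typer (-ty); nothing is asserted;
no `sorry`. What is PROVED here (`bsdOfMainConjectureRankOneAtTwo_of_drafts`): (a) ∧ (b) ∧ {GZK, modularity datum,
Mazur–Tate Σ² fact} ⟹ the crux BY NAME — so the currencies chosen below are CONSISTENT (everything cancels in L3), whatever
the refuter decides about their individual truth at `2`.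

CURRENCY CHOSEN (one consistent choice; H1 of the card): the `2`-adic height datum is the tree's `Σ²` receptacle
(`Dh.IsCanonicalSq`, Stein–Wuthrich normalisation `ĥ₂ = log₂ den x − log₂ Σ₂(z) = −4·h₂^{MST}` in rank one); `Reg₂ = padicRegulator Dh`;
`log₂(γ_cyc) = padicLog 2 (cyclotomicGenerator 2) = log₂ 5`; the anomalous factor `ε₂ = (1 − α⁻¹)²` sits on the `Ш` side in (a)
and on the regulator side in (b) (`B = ε₂·Reg₂` in L3). If the refuter's numerics (D11-style: `[T¹]L₂` from symbols, `Reg₂` from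
`Σ₂`) show that BMS's identity at `2` needs `4^r·Reg₂` in this currency, BOTH drafts change by the same factor and the closure below is
unchanged in shape.

* (a) `SchneiderLeadingTermAtTwoSq` — the body of the tree fact `Schneider1985_order_charGenerator` (IwasawaLeadingTerm.lean; BMS 2016
  Thm 1.7, printed for `p > 2`) with `5 ≤ p →` dropped, `p := 2`, and `Dh.IsCanonical ↦ Dh.IsCanonicalSq`. OPEN at `2` (Schneider 1985's
  hypotheses at `2` unverified, acq-00028).
* (b) `PerrinRiouComparisonAtTwo` — Perrin-Riou's 1987 rank-one comparison at `p = 2` on the cell: one rational `q` is both the `2`-adic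
  BSD quotient `ϖ·[T¹]L₂(f_E, α)·log₂5 / (ε₂·Reg₂)` and the archimedean one `L′(E,1)/(Ω_E·Reg_∞)` (`ϖ·Ω_E = Ω⁺_f` the MC binder,
  `Ω_E = realPeriodRat` incl. `c_∞` — H3: no power of `2` in the period on the cell). OPEN at `2` (Disegni 2017 Thm B = the `2`-adic GZ leg;
  in-print-assembly otherwise).
BSD is NOT proved by any of this; C3′ stays open.
-/

set_option autoImplicit false
set_option linter.dupNamespace false

noncomputable section

open scoped Classical MatrixGroups ModularForm

open CongruenceSubgroup WeierstrassCurve Literature.NumberTheory.EllipticCurves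
  Literature.NumberTheory.EllipticCurves.ModularForms Literature.NumberTheory.EllipticCurves.Greenberg1999
  Summit.BirchSwinnertonDyer.BirchSwinnertonDyer.Theorems.Rank1ResidualX1Defs
  Summit.BirchSwinnertonDyer.BirchSwinnertonDyer.Theorems.AlignedTransportAtTwoOrderTransfer
  Summit.BirchSwinnertonDyer.BirchSwinnertonDyer.Theorems.AlignedTransportAtTwoLeadingTermAlgebra

namespace Summit.BirchSwinnertonDyer.BirchSwinnertonDyer.Cruxes.BSDOfMainConjectureRankOneAtTwo.TypingDraft

/-- **DRAFT T-23008-a `SchneiderLeadingTermAtTwoSq`** — Perrin-Riou–Schneider / BMS Thm 1.7 AT `p = 2`, over the `Σ²` height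
receptacle: for `W/ℚ` globally minimal, good ordinary at `2`, every cyclotomic datum, every torsion dual datum with characteristic
generator `f_E`, and THE canonical `2`-adic height `Dh` (`IsCanonicalSq`): (1) `rank ≤ ord_T f_E`; (2) `ord_T f_E = rank ↔
Reg₂(Dh) ≠ 0 ∧ Ш[2^∞] finite`; (3) then `[T^r]f_E · (log₂ 5)^r · tors² = u · (1 − α⁻¹)² · #Ш[2^∞] · Reg₂(Dh) · ∏ c_v`, `u ∈ ℤ₂ˣ`.
DRAFT (currency H1 to be audited); nothing asserted. [cite: BalakrishnanMullerStein2015, Thm. 1.7 (printed for p > 2; the p = 2 text is ours)]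
[cite: Schneider1985, Thm. 2′ (hypotheses at p = 2 unverified)] -/
def SchneiderLeadingTermAtTwoSq : Prop :=
  ∀ (W : WeierstrassCurve ℚ) [W.IsElliptic] [W.IsGloballyMinimal],
    W.HasGoodReductionAtPrime 2 → ¬ (2 : ℤ) ∣ W.frobeniusTrace 2 →
    ∀ (κ : ZpExtension ℚ 2) (γ : Field.absoluteGaloisGroup ℚ),
      κ.IsCyclotomic → κ.IsTopGenerator γ → IsCyclotomicVariable 2 γ →
    ∀ (D : W.SelmerDualData κ γ) [Module.Finite (IwasawaAlgebra 2) D.X], D.IsTorsion →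
    ∀ (fE : IwasawaAlgebra 2), D.charIdeal = Ideal.span {fE} →
    ∀ (Dh : PAdicHeightData W 2), Dh.IsCanonicalSq →
      (W.mordellWeilRank : ℕ∞) ≤ fE.order ∧
      (fE.order = W.mordellWeilRank ↔
        (SchneiderConjecture Dh ∧ Finite (AddCommGroup.primaryComponent W.sha 2))) ∧
      (SchneiderConjecture Dh → Finite (AddCommGroup.primaryComponent W.sha 2) →
        ∃ u : ℤ_[2]ˣ,
          ((PowerSeries.coeff W.mordellWeilRank fE : ℤ_[2]) : ℚ_[2]) *
              padicLog 2 (cyclotomicGenerator 2) ^ W.mordellWeilRank * (W.torsionOrder : ℚ_[2]) ^ 2 =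
            ((u : ℤ_[2]) : ℚ_[2]) *
              ((1 - (unitRoot W 2 : ℚ_[2])⁻¹) ^ 2 *
                ((Nat.card (AddCommGroup.primaryComponent W.sha 2) : ℚ_[2]) * padicRegulator Dh * W.tamagawaProduct)))

/-- **DRAFT T-23008-b `PerrinRiouComparisonAtTwo`** — Perrin-Riou's rank-one comparison AT `p = 2` on the cell: for `W/ℚ` globally
minimal, good ordinary at `2`, no rational `2`-torsion, `r_an = 1`, every conductor-level newform `f` and rational `ϖ` with
`ϖ · Ω_E = Ω⁺_f`, and THE canonical `2`-adic height `Dh` (`IsCanonicalSq`) with `Reg₂(Dh) ≠ 0`: ONE rational number `q` satisfies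
`q · (1 − α⁻¹)² · Reg₂(Dh) = ϖ · [T¹]L₂(f, α) · log₂ 5` in `ℚ₂` and `q · Ω_E · Reg_∞(E) = L′(E,1)` in `ℂ`. DRAFT (currency as in (a));
nothing asserted. [cite: PerrinRiou1987, Thm. (rank-one comparison; printed for p ∤ 2N)] [cite: Disegni2017, Thm. B (p-adic Gross–Zagier, p = 2 allowed with 2 split in K)] -/
def PerrinRiouComparisonAtTwo : Prop :=
  ∀ (W : WeierstrassCurve ℚ) [W.IsElliptic] [W.IsGloballyMinimal],
    IsOrdinaryAt W 2 → (∀ x : ℚ, ¬ HasRationalTwoTorsionX W x) → W.analyticRank = 1 →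
    ∀ [NeZero (W.conductorNorm ℤ)] (f : CuspForm (Gamma0 (W.conductorNorm ℤ)) 2), IsNewformOf W f →
    ∀ (ϖ : ℚ), (ϖ : ℝ) * W.realPeriodRat = plusPeriod f →
    ∀ (Dh : PAdicHeightData W 2), Dh.IsCanonicalSq → SchneiderConjecture Dh →
      ∃ q : ℚ,
        (q : ℚ_[2]) * ((1 - (unitRoot W 2 : ℚ_[2])⁻¹) ^ 2 * padicRegulator Dh) =
            (ϖ : ℚ_[2]) * PowerSeries.coeff 1 (padicLFunction f (unitRoot W 2 : ℚ_[2])) *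
              padicLog 2 (cyclotomicGenerator 2) ∧
        (q : ℂ) * ((W.realPeriodRat : ℂ) * (W.regulator : ℂ)) = W.leadingLCoeff

/-- **KERNEL CHECK: the two drafts, in this one currency, close stub L.** (a) + (b) + Gross–Zagier–Kolyvagin
(`rank_eq_analyticRank_of_analyticRank_le_one`, PRINT) + modularity in the parametrisation currency
(`nonempty_modularParametrizationData`, PRINT) + the Mazur–Tate `Σ²` fact (`mazurTate_sigmaSq_existsUnique_two`, PRINT; it inhabits
the height receptacle at a good ordinary `2`) ⟹ `BSDOfMainConjectureRankOneAtTwo`. Route: GZK gives `rank = 1`; the modular datum gives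
`f`, `ϖ > 0`; the main conjecture at the (existing) cyclotomic datum gives a generator `g` with `ι g = ϖ·L₂(f,α)`, so `ord_T g = 1 = rank`
and (a)(2) gives `Reg₂(Dh) ≠ 0`; (a)(2)+(3) packaged as the adapter's Schneider-shaped law with `LOG = log₂ 5`, `B = ε₂·Reg₂(Dh)`;
`B ≠ 0` (`ε₂ = u·#Ẽ(𝔽₂)`, tree `exists_unit_one_sub_unitRoot_inv`); (b) is the comparison law with the same `A, B`; L3 concludes.
CONDITIONAL on two DRAFT statements; closes nothing; BSD is not proved. -/
theorem bsdOfMainConjectureRankOneAtTwo_of_drafts (ha : SchneiderLeadingTermAtTwoSq) (hb : PerrinRiouComparisonAtTwo)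
    (hGZK : rank_eq_analyticRank_of_analyticRank_le_one) (hmod : nonempty_modularParametrizationData)
    (hMT : mazurTate_sigmaSq_existsUnique_two) :
    Summit.BirchSwinnertonDyer.BirchSwinnertonDyer.Theses.AlignedTransportAtTwo.BSDOfMainConjectureRankOneAtTwo := by
  intro W _ _ _ hord ht _ hr hL hMC
  haveI : NeZero (W.conductorNorm ℤ) := ⟨(W.conductorNorm_pos_holds).ne'⟩
  -- rank one (GZK)
  obtain ⟨hrank, -⟩ := hGZK W (le_of_eq hr)
  have hrank1 : W.mordellWeilRank = 1 := by rw [hrank, hr]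
  -- the conductor-level newform and its period ratio (modularity datum)
  obtain ⟨Dm⟩ := hmod W
  obtain ⟨ϖ, hϖpos, hϖ, -⟩ := Dm.exists_rat_mul_realPeriodRat_eq_plusPeriod
  have hf : IsNewformOf W Dm.f := Dm.isNewformOf
  have hL1 : (padicLFunction Dm.f (unitRoot W 2 : ℚ_[2])).order = 1 := hL Dm.f hf
  -- THE canonical `2`-adic height (Σ² receptacle)
  obtain ⟨Dh, hDh⟩ := exists_isCanonicalSq_two hMT W hord.1 hord.2
  -- (a) packaged as the adapter's Schneider-shaped law, with `LOG = log₂ 5`, `B = ε₂ · Reg₂(Dh)`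
  set ε : ℚ_[2] := (1 - (unitRoot W 2 : ℚ_[2])⁻¹) ^ 2 with hε
  have hS : ∀ (κ : ZpExtension ℚ 2) (γ : Field.absoluteGaloisGroup ℚ),
      κ.IsCyclotomic → κ.IsTopGenerator γ → IsCyclotomicVariable 2 γ →
      ∀ (D : W.SelmerDualData κ γ) [Module.Finite (IwasawaAlgebra 2) D.X], D.IsTorsion →
      ∀ fE : IwasawaAlgebra 2, D.charIdeal = Ideal.span {fE} → fE.order = (W.mordellWeilRank : ℕ∞) →
        ∃ u : ℤ_[2]ˣ, ((PowerSeries.coeff 1 fE : ℤ_[2]) : ℚ_[2]) * padicLog 2 (cyclotomicGenerator 2) *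
            (W.torsionOrder : ℚ_[2]) ^ 2 =
          ((u : ℤ_[2]) : ℚ_[2]) * (Nat.card (AddCommGroup.primaryComponent W.sha 2) : ℚ_[2]) * (ε * padicRegulator Dh) *
            (W.tamagawaProduct : ℚ_[2]) := by
    intro κ γ hκ hγ hγ' D _ hX fE hchar hordfE
    obtain ⟨-, hiff, h3⟩ := ha W hord.1 hord.2 κ γ hκ hγ hγ' D hX fE hchar Dh hDh
    obtain ⟨hSch, hfin⟩ := hiff.mp hordfE
    obtain ⟨u, hu⟩ := h3 hSch hfin
    rw [hrank1, pow_one] at hu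
    exact ⟨u, by rw [hu]; ring⟩
  -- `Reg₂(Dh) ≠ 0` from (a)(2) at the main-conjecture generator
  have hSch : SchneiderConjecture Dh := by
    obtain ⟨κ, hκ, γ, hγ, hγ'⟩ := exists_isCyclotomic_isTopGenerator_isCyclotomicVariable_holds 2
    obtain ⟨D⟩ := W.nonempty_selmerDualData_holds κ γ hγ
    haveI : Module.Finite (IwasawaAlgebra 2) D.X := D.module_finite_holds hγ
    obtain ⟨hX, g, hchar, hι⟩ := hMC κ γ hκ hγ hγ' Dm.f hf ϖ hϖ D
    have hc : (ϖ : ℚ_[2]) ≠ 0 := by exact_mod_cast hϖpos.ne'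
    have hordg : g.order = (W.mordellWeilRank : ℕ∞) := by
      rw [← order_eq_order_of_iwasawaToPowerSeries_eq_C_mul 2 hc hι, hL1, hrank1]; rfl
    obtain ⟨-, hiff, -⟩ := ha W hord.1 hord.2 κ γ hκ hγ hγ' D hX g hchar Dh hDh
    exact (hiff.mp hordg).1
  -- `B = ε₂ · Reg₂ ≠ 0`
  have hε0 : ε ≠ 0 := by
    obtain ⟨u₂, hu₂⟩ := exists_unit_one_sub_unitRoot_inv 2 W hord
    have hN : (W.reductionPointCount 2 : ℚ_[2]) ≠ 0 := by exact_mod_cast (W.reductionPointCount_pos 2).ne'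
    have hu1 : ‖((u₂ : ℤ_[2]) : ℚ_[2])‖ = 1 := PadicInt.isUnit_iff.mp u₂.isUnit
    have hu0 : ((u₂ : ℤ_[2]) : ℚ_[2]) ≠ 0 := by
      rw [← norm_pos_iff, hu1]; exact one_pos
    rw [hε, hu₂]
    exact pow_ne_zero 2 (mul_ne_zero hu0 hN)
  have hB : ε * padicRegulator Dh ≠ 0 := mul_ne_zero hε0 hSch
  -- the leading-term law (adapter) and the comparison law (b), same `A`, `B`
  have hLT := leadingTermLaw_of_schneiderShape_of_mazurMainConjecture W 2 hf hϖ hS hrank1 hL1 hMC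
  obtain ⟨q, hq1, hq2⟩ := hb W hord ht hr Dm.f hf ϖ hϖ Dh hDh hSch
  refine bsdp_of_leadingTerm_of_comparison W 2 hGZK (le_of_eq hr) hB hLT ⟨q, ?_, hq2⟩
  rw [hq1]

end Summit.BirchSwinnertonDyer.BirchSwinnertonDyer.Cruxes.BSDOfMainConjectureRankOneAtTwo.TypingDraft

end
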